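import Mathlib
import Summits.CriticalPhenomena.PercolationContinuityZ3.Theorems.PercNearOneGluingNoHeavyLowerTailOrientedAntipodalHallOmegaSocket

/-!
# The oriented antipodal Hall theorem for ACYCLIC type sets on any number of petals

Helper file for crux `stmt-CriticalPhenomena-4575` (`NoHeavyLowerTail`, route `PercNearOneGluingNoHeavy`),
new-inequality factory seat `prim-ineq-gen-3` (gen 13).  Everything here is PROVED.

Setting of `…OrientedAntipodalHall`: `f : Finset α → Lab k` monotone, ground set `S`, antipodal bads `X`
(`f X = C_{i X}`, `f (S \ X) = C_{j X}`), good sets `U` (`f U = A`, `f (S \ U) = B`).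

**Theorem (`card_le_card_goods_above_acyclic`, `exists_injective_good_above_acyclic`).**  Let `D` be a family
of antipodal bad subsets of `S` whose ordered types `(i X, j X)` form an ACYCLIC digraph on the petals — i.e.
there is a height function `h` on the petals with `h (j X) < h (i X)` for every `X ∈ D` (this contains every
opposite-free type set without directed cycles: all transitive tournaments `TT_k`, all 'DAG' classes; on four
petals 30 of the 41 opposite-free classes, on five petals 301 of 581, for every `k` the class `TT_k`).  Then
`#D ≤ #{good sets above a member of D}`, and the members of `D` have distinct good representatives.

*Proof.*  Count against the ONE-SIDED ENLARGEMENT `G = {F ⊆ S : f F = B, f (S \ F) ≠ B, F ⊆ S \ X (X ∈ D)}`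
of the co-goods (the Ω-socket `card_le_card_goods_above_of_indep`): the complemented members `S \ X` together
with the pseudo-sets `E ∈ G`, `f (S \ E) = Cᵣ`, form ONE ranked Marica–Schönheim family — rank = height of
the petal `f (S \ U)`; for `rank U ≤ rank U'` the difference `U \ U'` lies in `G` (its label is `≤ f U` and
`≤ f (S \ U')`, two different petals or `B`, by acyclicity), and sets of different rank are never nested — so
their plain vectors are linearly independent (`ThreeFamilyRank.linearIndependent_chi_of_rank`, the ranked
form of the Marica–Schönheim mechanism).  No rigidity theorem is needed.  (prim-ineq-gen-3 gen 13,
2026-08-21; memo FINDINGS-gen13.md in `run/shared/lean/prim/prim-ineq-gen-3/`.)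
-/

namespace Summit.CriticalPhenomena.PercolationContinuityZ3.Theorems

namespace ThreeFamilyRank

open Finset Module
open scoped FinsetFamily

variable {α : Type*} [DecidableEq α]

/-- **Ranked Marica–Schönheim independence.**  If a family `P` carries a rank `ρ` such that `X \ X' ∈ G`
whenever `ρ X ≤ ρ X'` and no member lies inside a member of larger rank, then the plain vectors of `P` are
linearly independent in `ℚ^G` (`G` down-closed). -/
theorem linearIndependent_chi_of_rank (G : Finset (Finset α)) (hG : ∀ E ∈ G, ∀ F, F ⊆ E → F ∈ G)
    (P : Finset (Finset α)) (ρ : Finset α → ℕ)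
    (hdiff : ∀ X ∈ P, ∀ X' ∈ P, ρ X ≤ ρ X' → X \ X' ∈ G)
    (hnc : ∀ X ∈ P, ∀ X' ∈ P, ρ X < ρ X' → ¬ X ⊆ X') :
    LinearIndependent ℚ (fun X : ↥P => chi G (X : Finset α)) := by
  rw [linearIndependent_iff']
  intro s g hsum
  by_contra hcon
  set T : Finset ↥P := s.filter fun i => g i ≠ 0 with hT
  have hTne : T.Nonempty := by
    by_contra h'
    rw [Finset.not_nonempty_iff_eq_empty, hT, Finset.filter_eq_empty_iff] at h'
    exact hcon fun i hi => by simpa using h' hi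
  -- maximal rank among the members with nonzero coefficient
  obtain ⟨X₁, hX₁, hmax⟩ := Finset.exists_max_image T (fun i : ↥P => ρ (i : Finset α)) hTne
  set T' : Finset ↥P := T.filter fun i => ρ (i : Finset α) = ρ (X₁ : Finset α) with hT'
  have hT'ne : T'.Nonempty := ⟨X₁, Finset.mem_filter.mpr ⟨hX₁, rfl⟩⟩
  -- minimal cardinality among those of maximal rank
  obtain ⟨X₀, hX₀', hmin⟩ := Finset.exists_min_image T' (fun i : ↥P => #(i : Finset α)) hT'ne
  obtain ⟨hX₀T, hρ₀⟩ := Finset.mem_filter.mp hX₀'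
  obtain ⟨hX₀s, hg₀⟩ := Finset.mem_filter.mp hX₀T
  -- test the relation against `cochi X₀`
  have h0 : sform G (∑ i ∈ s, g i • chi G (i : Finset α)) (cochi G X₀) = 0 := by
    rw [hsum, LinearMap.map_zero, LinearMap.zero_apply]
  rw [map_sum, LinearMap.sum_apply] at h0
  simp only [LinearMap.map_smul, LinearMap.smul_apply, smul_eq_mul] at h0
  have h1 : ∀ i ∈ s, g i * sform G (chi G (i : Finset α)) (cochi G X₀) =
      if i = X₀ then g X₀ else 0 := by
    intro i hi
    by_cases hgi : g i = 0
    · by_cases hiX : i = X₀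
      · subst hiX; exact absurd hgi hg₀
      · rw [if_neg hiX, hgi, zero_mul]
    have hiT : i ∈ T := Finset.mem_filter.mpr ⟨hi, hgi⟩
    have hρle : ρ (i : Finset α) ≤ ρ (X₀ : Finset α) := by rw [hρ₀]; exact hmax i hiT
    rw [sform_chi_cochi G hG (hdiff _ i.2 _ X₀.2 hρle)]
    by_cases hiX : i = X₀
    · subst hiX; simp
    · rw [if_neg hiX]
      by_cases hsub : (i : Finset α) ⊆ X₀
      · exfalso
        rcases lt_or_eq_of_le hρle with hlt | heq
        · exact hnc _ i.2 _ X₀.2 hlt hsub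
        · have hiT' : i ∈ T' := Finset.mem_filter.mpr ⟨hiT, heq.trans hρ₀⟩
          have hne : (i : Finset α) ≠ X₀ := fun h => hiX (Subtype.ext h)
          have hlt : #(i : Finset α) < #(X₀ : Finset α) :=
            Finset.card_lt_card (lt_of_le_of_ne hsub hne)
          exact absurd (hmin i hiT') (not_le.mpr hlt)
      · simp [hsub]
  rw [Finset.sum_congr rfl h1, Finset.sum_ite_eq' s X₀, if_pos hX₀s] at h0
  exact hg₀ h0

end ThreeFamilyRank

namespace OrientedAntipodalHall

open Finset Module AntipodalStrongHarris AntipodalStrongHarris.Lab ThreeFamilyRank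
open scoped FinsetFamily

variable {α : Type*} [DecidableEq α] {k : ℕ}

/-- A label above a petal is not the bottom label. -/
theorem ne_bot_of_petal_le {i : Fin k} {c : Lab k} (h : petal i ≤ c) : c ≠ bot := by
  rw [le_def] at h
  rcases h with h | h | h
  · exact absurd h (by simp)
  · rw [h]; simp
  · rw [← h]; simp

/-- Two petals are comparable only when they are equal. -/
theorem petal_le_petal_iff {i j : Fin k} : (petal i : Lab k) ≤ petal j ↔ i = j := by
  rw [le_def]
  constructor
  · rintro (h | h | h)
    · exact absurd h (by simp)
    · exact absurd h (by simp)
    · exact Lab.petal.inj h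
  · rintro rfl; exact Or.inr (Or.inr rfl)

/-- **Oriented antipodal Hall theorem for acyclic type sets, counting form.**  `f` monotone into `Lab k`; `D`
a family of antipodal bad subsets of `S` (`f X = C_{i X}`, `f (S \ X) = C_{j X}`) whose types are acyclic:
`h (j X) < h (i X)` for a height function `h` on the petals.  Then at least `#D` good sets (`f U = A`,
`f (S \ U) = B`) contain a member of `D`. -/
theorem card_le_card_goods_above_acyclic (S : Finset α) {f : Finset α → Lab k}
    (hf : ∀ ⦃X Y : Finset α⦄, X ⊆ Y → f X ≤ f Y) (D : Finset (Finset α)) (i j : Finset α → Fin k)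
    (h : Fin k → ℕ) (hDS : ∀ X ∈ D, X ⊆ S) (hDi : ∀ X ∈ D, f X = petal (i X))
    (hDj : ∀ X ∈ D, f (S \ X) = petal (j X)) (hacyc : ∀ X ∈ D, h (j X) < h (i X)) :
    #D ≤ #{U ∈ S.powerset | f U = top ∧ f (S \ U) = bot ∧ ∃ X ∈ D, X ⊆ U} := by
  classical
  set G : Finset (Finset α) := {F ∈ S.powerset | f F = bot ∧ f (S \ F) ≠ bot ∧ ∃ X ∈ D, F ⊆ S \ X}
    with hG
  set Ψ : Finset (Finset α) := {F ∈ G | f (S \ F) ≠ top} with hΨ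
  have hDb : ∀ X ∈ D, f (S \ X) ≠ bot := fun X hX => by rw [hDj X hX]; simp
  refine card_le_card_goods_above_of_indep S D G Ψ hDS hDb hG hΨ ?_
  -- `G` is down-closed
  have hGdown : ∀ E ∈ G, ∀ F, F ⊆ E → F ∈ G := by
    intro E hE F hFE
    rw [hG, mem_filter, mem_powerset] at hE ⊢
    obtain ⟨hES, hEbot, hEnb, X, hX, hEX⟩ := hE
    refine ⟨hFE.trans hES, ?_, ?_, X, hX, hFE.trans hEX⟩
    · have h1 := hf hFE
      rw [hEbot, le_def] at h1
      rcases h1 with h1 | h1 | h1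
      · exact h1
      · exact absurd h1 (by simp)
      · exact h1
    · intro hFbot
      have h1 := hf (sdiff_subset_sdiff (le_refl S) hFE)
      rw [hFbot, le_def] at h1
      rcases h1 with h1 | h1 | h1
      · exact hEnb h1
      · exact absurd h1 (by simp)
      · exact hEnb h1
  -- the rank of a set: the height of the petal labelling its complement (`0` if none)
  let ρ : Finset α → ℕ := fun U => match f (S \ U) with
    | petal r => h r
    | _ => 0
  have hρ : ∀ U (r : Fin k), f (S \ U) = petal r → ρ U = h r := by
    intro U r hr
    simp only [ρ, hr]
  -- every element of the family has a petal-labelled complement inside `S`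
  set P : Finset (Finset α) := D.image (fun X => S \ X) ∪ Ψ with hP
  have hPlab : ∀ U ∈ P, U ⊆ S ∧ (∃ r, f (S \ U) = petal r) ∧ (∃ X ∈ D, U ⊆ S \ X) ∧
      (f U = bot ∨ ∃ X ∈ D, U = S \ X) := by
    intro U hU
    rcases mem_union.mp hU with hU | hU
    · obtain ⟨X, hX, rfl⟩ := mem_image.mp hU
      refine ⟨sdiff_subset, ⟨i X, ?_⟩, ⟨X, hX, le_rfl⟩, Or.inr ⟨X, hX, rfl⟩⟩
      rw [Finset.sdiff_sdiff_eq_self (hDS X hX), hDi X hX]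
    · rw [hΨ, mem_filter, hG, mem_filter, mem_powerset] at hU
      obtain ⟨⟨hUS, hUbot, hUnb, X, hX, hUX⟩, hUnt⟩ := hU
      refine ⟨hUS, ?_, ⟨X, hX, hUX⟩, Or.inl hUbot⟩
      rcases hc : f (S \ U) with _ | r | _
      · exact absurd hc hUnb
      · exact ⟨r, rfl⟩
      · exact absurd hc hUnt
  -- the rank of a member `S \ X` is the height of `i X`, which exceeds the height of its own label `j X`
  have hmem : ∀ X ∈ D, ρ (S \ X) = h (i X) ∧ f (S \ X) = petal (j X) := by
    intro X hX
    refine ⟨hρ _ _ ?_, ?_⟩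
    · rw [Finset.sdiff_sdiff_eq_self (hDS X hX), hDi X hX]
    · exact hDj X hX
  refine linearIndependent_chi_of_rank G hGdown P ρ ?_ ?_
  · -- differences `U \ U'` with `ρ U ≤ ρ U'` lie in `G`
    intro U hU U' hU' hle
    obtain ⟨hUS, ⟨r, hr⟩, ⟨X, hX, hUX⟩, hUl⟩ := hPlab U hU
    obtain ⟨-, ⟨r', hr'⟩, -, -⟩ := hPlab U' hU'
    rw [hG, mem_filter, mem_powerset]
    refine ⟨sdiff_subset.trans hUS, ?_, ?_, X, hX, sdiff_subset.trans hUX⟩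
    · -- label of `U \ U'` is `B`
      rcases hUl with hUbot | ⟨X₀, hX₀, rfl⟩
      · have h1 := hf (sdiff_subset : U \ U' ⊆ U)
        rw [hUbot, le_def] at h1
        rcases h1 with h1 | h1 | h1
        · exact h1
        · exact absurd h1 (by simp)
        · exact h1
      · -- `U = S \ X₀` has label `C_{j X₀}`; `S \ U'` has label `C_{r'}` with `h r' ≥ ρ U = h (i X₀) > h (j X₀)`
        have hρU : ρ (S \ X₀) = h (i X₀) := (hmem X₀ hX₀).1
        have hρU' : ρ U' = h r' := hρ U' r' hr'
        have hne : j X₀ ≠ r' := by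
          intro heq
          have := hacyc X₀ hX₀
          rw [heq, ← hρU', ← hρU] at this
          exact absurd hle (not_le.mpr this)
        refine eq_bot_of_le_petal hne ?_ ?_
        · rw [← (hmem X₀ hX₀).2]; exact hf sdiff_subset
        · rw [← hr']
          refine hf ?_
          intro a ha
          rw [mem_sdiff] at ha ⊢
          exact ⟨(mem_sdiff.mp ha.1).1, ha.2⟩
    · -- label of `S \ (U \ U')` is not `B`: it lies above `f (S \ U) = C_r`
      have h1 : f (S \ U) ≤ f (S \ (U \ U')) := hf (sdiff_subset_sdiff (le_refl S) sdiff_subset)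
      rw [hr] at h1
      exact ne_bot_of_petal_le h1
  · -- sets of smaller rank are not contained in sets of larger rank
    intro U hU U' hU' hlt hsub
    obtain ⟨hUS, ⟨r, hr⟩, -, -⟩ := hPlab U hU
    obtain ⟨hU'S, ⟨r', hr'⟩, -, -⟩ := hPlab U' hU'
    have h1 : f (S \ U') ≤ f (S \ U) := hf (sdiff_subset_sdiff (le_refl S) hsub)
    rw [hr, hr', petal_le_petal_iff] at h1
    rw [hρ U r hr, hρ U' r' hr', h1] at hlt
    exact lt_irrefl _ hlt

/-- **Oriented antipodal Hall theorem for acyclic type sets, SDR form.**  Under the hypotheses of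
`card_le_card_goods_above_acyclic` the members of `D` have DISTINCT good representatives above them. -/
theorem exists_injective_good_above_acyclic (S : Finset α) {f : Finset α → Lab k}
    (hf : ∀ ⦃X Y : Finset α⦄, X ⊆ Y → f X ≤ f Y) (D : Finset (Finset α)) (i j : Finset α → Fin k)
    (h : Fin k → ℕ) (hDS : ∀ X ∈ D, X ⊆ S) (hDi : ∀ X ∈ D, f X = petal (i X))
    (hDj : ∀ X ∈ D, f (S \ X) = petal (j X)) (hacyc : ∀ X ∈ D, h (j X) < h (i X)) :
    ∃ φ : D → Finset α, Function.Injective φ ∧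
      ∀ X : D, (X : Finset α) ⊆ φ X ∧ φ X ⊆ S ∧ f (φ X) = top ∧ f (S \ φ X) = bot := by
  classical
  let t : D → Finset (Finset α) := fun X =>
    {U ∈ S.powerset | f U = top ∧ f (S \ U) = bot ∧ (X : Finset α) ⊆ U}
  have hHall : ∀ s : Finset D, #s ≤ #(s.biUnion t) := by
    intro s
    set D' : Finset (Finset α) := s.map (Function.Embedding.subtype _) with hD'
    have hD'sub : ∀ X ∈ D', X ∈ D := by
      intro X hX
      obtain ⟨x, -, rfl⟩ := mem_map.mp hX
      exact x.2
    have hcard : #s = #D' := (card_map _).symm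
    have hle := card_le_card_goods_above_acyclic S hf D' i j h (fun X hX => hDS X (hD'sub X hX))
      (fun X hX => hDi X (hD'sub X hX)) (fun X hX => hDj X (hD'sub X hX))
      (fun X hX => hacyc X (hD'sub X hX))
    have hgoods : {U ∈ S.powerset | f U = top ∧ f (S \ U) = bot ∧ ∃ X ∈ D', X ⊆ U} ⊆
        s.biUnion t := by
      intro U hU
      rw [mem_filter, mem_powerset] at hU
      obtain ⟨hUS, hUtop, hUbot, X, hX, hXU⟩ := hU
      obtain ⟨x, hx, rfl⟩ := mem_map.mp hX
      rw [mem_biUnion]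
      refine ⟨x, hx, ?_⟩
      simp only [t, mem_filter, mem_powerset]
      exact ⟨hUS, hUtop, hUbot, hXU⟩
    calc #s = #D' := hcard
      _ ≤ #{U ∈ S.powerset | f U = top ∧ f (S \ U) = bot ∧ ∃ X ∈ D', X ⊆ U} := hle
      _ ≤ #(s.biUnion t) := card_le_card hgoods
  obtain ⟨φ, hφinj, hφ⟩ := (all_card_le_biUnion_card_iff_exists_injective t).mp hHall
  refine ⟨φ, hφinj, fun X => ?_⟩
  have hX := hφ X
  simp only [t, mem_filter, mem_powerset] at hX
  exact ⟨hX.2.2.2, hX.1, hX.2.1, hX.2.2.1⟩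

/-- **Corollary: the transitive tournament on any number of petals.**  If the petals carry a linear "height"
(an injection into `ℕ`) and every bad in `D` has its set-label strictly above its complement-label, the members
of `D` have distinct good representatives — Theorem O for `TT_k`, every `k`. -/
theorem exists_injective_good_above_transitiveTournament (S : Finset α) {f : Finset α → Lab k}
    (hf : ∀ ⦃X Y : Finset α⦄, X ⊆ Y → f X ≤ f Y) (D : Finset (Finset α)) (i j : Finset α → Fin k)
    (hDS : ∀ X ∈ D, X ⊆ S) (hDi : ∀ X ∈ D, f X = petal (i X))
    (hDj : ∀ X ∈ D, f (S \ X) = petal (j X)) (hlt : ∀ X ∈ D, j X < i X) :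
    ∃ φ : D → Finset α, Function.Injective φ ∧
      ∀ X : D, (X : Finset α) ⊆ φ X ∧ φ X ⊆ S ∧ f (φ X) = top ∧ f (S \ φ X) = bot :=
  exists_injective_good_above_acyclic S hf D i j (fun r => (r : ℕ)) hDS hDi hDj
    (fun X hX => by exact_mod_cast hlt X hX)

end OrientedAntipodalHall

end Summit.CriticalPhenomena.PercolationContinuityZ3.Theorems
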